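import Literature.MathematicalPhysics.KineticTheory.BoltzmannSolutionsUkaiVelocity
import Literature.MathematicalPhysics.KineticTheory.HardSphereEulerProofs
import HarnessLib

/-!
# Collision-kernel symmetries against a local Maxwellian (route `EnskogAdjointDuality`, K4 statics I)

Route `EnskogAdjointDuality` of `AtomisticToContinuum/HydrodynamicLimit`, support item
`EquilibriumCollisionResidual` (stmt-AtomisticToContinuum-9169) and the bookkeeping of the crux
`CollisionResidualVanishes` (stmt-AtomisticToContinuum-14658).  Velocity-space lemmas behind the exact
vanishing of the Enskog centring term `½ ∫∫ f_s L^N_s φ_s` at global equilibrium (assembled on `𝕋³` in the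
companion file `EnskogAdjointDualityEquilibriumCollisionResidualCentring`):

* `localMaxwellian_collide_mul` — `M(v′) M(w′) = M(v) M(w)` for `M = M_{1,u,θ}` (momentum + energy
  conservation of the elastic collision);
* (kernel bounds `((v−w)·ω)₊ ≥ 0`, `≤ (1+‖v‖)(1+‖w‖)` are reused from `UkaiLanford`);
* `integrable_one_add_norm_pow_mul_localMaxwellian`, `integrable_localMaxwellian_kernel_mul` — Gaussian
  moments and domination of `M(v)M(w)((v−w)·ω)₊ W(v,w)` for polynomially bounded weights;
* `integral_localMaxwellian_kernel_collide_fst/snd` — gain-term symmetries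
  `∫∫ M M ((v−w)·ω)₊ ψ(v′) = ∫∫ M M ((v−w)·ω)₊ ψ(w)` and `… ψ(w′) = … ψ(v)` (swapped collision change of
  variables `integral_comp_collideSwap`, unit Jacobian, kernel invariant `IsGradCutoffKernel.swap_collide`);
* `integral_localMaxwellian_kernel_bracket` — for continuous `ψ₁, ψ₂` of quadratic growth,
  `∫∫ M M ((v−w)·ω)₊ [ψ₁(v′) + ψ₂(w′) − ψ₁(v) − ψ₂(w)] = q(ψ₂) − q(ψ₁)`,
  `q(ψ) = ∫∫ M M ((v−w)·ω)₊ (ψ(v) − ψ(w))`, with the uniform bound `|q(ψ)| ≤ 2C (∫(1+‖v‖)³M)²`.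

References: C. Cercignani, R. Illner, M. Pulvirenti, *The Mathematical Theory of Dilute Gases* (1994),
§3.1 (collision invariance of the kernel, unit Jacobian) [CIP1994].
-/

noncomputable section

open MeasureTheory Metric Set Filter Topology Function
open scoped InnerProductSpace ENNReal

namespace Summit.AtomisticToContinuum.HydrodynamicLimit.Theorems.EnskogAdjointDuality

open Literature.Analysis.FluidPDE Literature.MathematicalPhysics.KineticTheory

/-! ## Velocity-space lemmas (any finite-dimensional inner product space) -/

section Velocity

variable {E : Type*} [NormedAddCommGroup E] [InnerProductSpace ℝ E]

/-- The collision map commutes with a common translation of both velocities: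
`collide ω (v − u, w − u) = (v′ − u, w′ − u)`. [folklore] -/
theorem collide_sub_sub (ω : sphere (0 : E) 1) (u : E) (p : E × E) :
    collide ω (p.1 - u, p.2 - u) = ((collide ω p).1 - u, (collide ω p).2 - u) := by
  simp only [collide, sub_sub_sub_cancel_right, Prod.mk.injEq]
  constructor <;> abel

/-- **`M(v′) M(w′) = M(v) M(w)` for a local Maxwellian**: the product of local Maxwellians with common
drift `u` and temperature `θ` is invariant under the elastic collision map (conservation of momentum
and kinetic energy, `norm_sq_collide_fst_add_norm_sq_collide_snd`). [cite: CIP1994, §3.1] -/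
theorem localMaxwellian_collide_mul (θ : ℝ) (u : E) (ω : sphere (0 : E) 1) (p : E × E) :
    localMaxwellian 1 θ u (collide ω p).1 * localMaxwellian 1 θ u (collide ω p).2 =
      localMaxwellian 1 θ u p.1 * localMaxwellian 1 θ u p.2 := by
  have key : ‖(collide ω p).1 - u‖ ^ 2 + ‖(collide ω p).2 - u‖ ^ 2 =
      ‖p.1 - u‖ ^ 2 + ‖p.2 - u‖ ^ 2 := by
    have h := norm_sq_collide_fst_add_norm_sq_collide_snd ω (p.1 - u, p.2 - u)
    rw [collide_sub_sub] at h
    exact h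
  simp only [localMaxwellian, one_mul]
  rw [mul_mul_mul_comm, ← Real.exp_add, mul_mul_mul_comm, ← Real.exp_add]
  congr 1
  rw [← add_div, ← add_div, ← neg_add, ← neg_add, key]

/-- `‖v′‖² ≤ ‖v‖² + ‖w‖²` and `‖w′‖² ≤ ‖v‖² + ‖w‖²` (energy conservation). [folklore] -/
theorem norm_sq_collide_le (ω : sphere (0 : E) 1) (p : E × E) :
    ‖(collide ω p).1‖ ^ 2 ≤ ‖p.1‖ ^ 2 + ‖p.2‖ ^ 2 ∧ ‖(collide ω p).2‖ ^ 2 ≤ ‖p.1‖ ^ 2 + ‖p.2‖ ^ 2 := by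
  have h := norm_sq_collide_fst_add_norm_sq_collide_snd ω p
  constructor <;> nlinarith [sq_nonneg ‖(collide ω p).1‖, sq_nonneg ‖(collide ω p).2‖]

/-- `1 + a² + b² ≤ ((1 + a)(1 + b))²` for `a, b ≥ 0`. [folklore] -/
theorem one_add_sq_add_sq_le {a b : ℝ} (ha : 0 ≤ a) (hb : 0 ≤ b) :
    1 + a ^ 2 + b ^ 2 ≤ ((1 + a) * (1 + b)) ^ 2 := by
  nlinarith [mul_nonneg ha hb, mul_nonneg (mul_nonneg ha hb) (mul_nonneg ha hb)]

variable [FiniteDimensional ℝ E] [MeasurableSpace E] [BorelSpace E]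

/-- Polynomially weighted local Maxwellians are Lebesgue integrable: `(1 + ‖v‖)ⁿ M_{1,u,θ}(v) ∈ L¹(dv)`
for `θ > 0` (Gaussian moments of `gaussMeasure u θ`, whose Lebesgue density is `M_{1,u,θ}`).
[folklore] -/
theorem integrable_one_add_norm_pow_mul_localMaxwellian {θ : ℝ} (hθ : 0 < θ) (u : E) (n : ℕ) :
    Integrable (fun v : E => (1 + ‖v‖) ^ n * localMaxwellian 1 θ u v) := by
  have h : Integrable (fun v : E => (1 + ‖v‖) ^ n) (gaussMeasure u θ) := by
    have h0 : MemLp (fun v : E => ‖v‖) (n : ℝ≥0∞) (gaussMeasure u θ) :=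
      (ProbabilityTheory.IsGaussian.memLp_id (gaussMeasure u θ) n (ENNReal.natCast_ne_top n)).norm
    have h1 : MemLp (fun v : E => 1 + ‖v‖) (n : ℝ≥0∞) (gaussMeasure u θ) :=
      (memLp_const (1 : ℝ)).add h0
    refine h1.integrable_norm_pow'.congr (ae_of_all _ fun v => ?_)
    change ‖1 + ‖v‖‖ ^ n = (1 + ‖v‖) ^ n
    rw [Real.norm_of_nonneg (by positivity)]
  rw [← withDensity_localMaxwellian_eq_gaussMeasure hθ u,
    integrable_withDensity_iff_integrable_smul'
      (continuous_localMaxwellian 1 θ u).measurable.ennreal_ofReal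
      (Eventually.of_forall fun _ => ENNReal.ofReal_lt_top)] at h
  refine h.congr (Eventually.of_forall fun v => ?_)
  simp only [ENNReal.toReal_ofReal (localMaxwellian_nonneg zero_le_one hθ.le u v), smul_eq_mul]
  ring

/-- **Domination of the Maxwellian-weighted two-velocity integrands.** For `θ > 0`, a fixed direction
`ω` and an a.e.-strongly measurable weight `|W(v, w)| ≤ C ((1 + ‖v‖)(1 + ‖w‖))ᵐ`, the integrand
`M(v) M(w) ((v−w)·ω)₊ W(v, w)` is integrable on `E × E` (dominated by `|C| ρ(v) ρ(w)`,
`ρ = (1 + ‖·‖)^{m+1} M ∈ L¹`). [folklore] -/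
theorem integrable_localMaxwellian_kernel_mul {θ : ℝ} (hθ : 0 < θ) (u : E) (ω : sphere (0 : E) 1)
    {W : E × E → ℝ} (hWm : AEStronglyMeasurable W ((volume : Measure E).prod volume))
    {C : ℝ} {m : ℕ} (hW : ∀ p, |W p| ≤ C * ((1 + ‖p.1‖) * (1 + ‖p.2‖)) ^ m) :
    Integrable (fun p : E × E => localMaxwellian 1 θ u p.1 * localMaxwellian 1 θ u p.2 *
        hardSphereKernel p ω * W p) ((volume : Measure E).prod volume) := by
  set ρ : E → ℝ := fun v => (1 + ‖v‖) ^ (m + 1) * localMaxwellian 1 θ u v with hρ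
  have hρi : Integrable ρ := integrable_one_add_norm_pow_mul_localMaxwellian hθ u (m + 1)
  have hdom : Integrable (fun p : E × E => |C| * (ρ p.1 * ρ p.2)) ((volume : Measure E).prod volume) :=
    (hρi.mul_prod hρi).const_mul _
  refine hdom.mono' ?_ (Eventually.of_forall fun p => ?_)
  · have hM : Continuous fun p : E × E =>
        localMaxwellian 1 θ u p.1 * localMaxwellian 1 θ u p.2 * hardSphereKernel p ω := by
      unfold hardSphereKernel
      have h1 := continuous_localMaxwellian 1 θ u
      fun_prop
    exact hM.aestronglyMeasurable.mul hWm
  obtain ⟨v, w⟩ := p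
  have hMv := localMaxwellian_nonneg zero_le_one hθ.le u v
  have hMw := localMaxwellian_nonneg zero_le_one hθ.le u w
  have hK0 := UkaiLanford.hardSphereKernel_nonneg' (v, w) ω
  have hK := UkaiLanford.hardSphereKernel_le_weight (v, w) ω
  rw [Real.norm_eq_abs, abs_mul, abs_mul, abs_mul, abs_of_nonneg hMv, abs_of_nonneg hMw,
    abs_of_nonneg hK0]
  set X : ℝ := (1 + ‖v‖) * (1 + ‖w‖) with hX
  have hX0 : 0 ≤ X := by positivity
  have hWX : |W (v, w)| ≤ |C| * X ^ m :=
    (hW (v, w)).trans (mul_le_mul_of_nonneg_right (le_abs_self _) (by positivity))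
  have hρvw : ρ v * ρ w = X ^ (m + 1) * (localMaxwellian 1 θ u v * localMaxwellian 1 θ u w) := by
    simp only [hρ, hX, mul_pow]
    ring
  calc localMaxwellian 1 θ u v * localMaxwellian 1 θ u w * hardSphereKernel (v, w) ω * |W (v, w)|
      ≤ localMaxwellian 1 θ u v * localMaxwellian 1 θ u w * X * (|C| * X ^ m) :=
        mul_le_mul (mul_le_mul_of_nonneg_left hK (mul_nonneg hMv hMw)) hWX (abs_nonneg _)
          (by positivity)
    _ = |C| * (ρ v * ρ w) := by rw [hρvw]; ring

/-- **Gain-term symmetry, first particle**: `∫∫ M M ((v−w)·ω)₊ ψ(v′) = ∫∫ M M ((v−w)·ω)₊ ψ(w)`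
(change of variables `(v, w) ↦ (w′, v′)`, unit Jacobian, kernel and `M ⊗ M` invariant; no
integrability needed since the substitution is a measure-preserving equivalence). [cite: CIP1994, §3.1] -/
theorem integral_localMaxwellian_kernel_collide_fst (θ : ℝ) (u : E) (ω : sphere (0 : E) 1)
    (ψ : E → ℝ) :
    ∫ p, localMaxwellian 1 θ u p.1 * localMaxwellian 1 θ u p.2 * hardSphereKernel p ω *
        ψ (collide ω p).1 ∂((volume : Measure E).prod volume) =
      ∫ p, localMaxwellian 1 θ u p.1 * localMaxwellian 1 θ u p.2 * hardSphereKernel p ω * ψ p.2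
        ∂((volume : Measure E).prod volume) := by
  have h := integral_comp_collideSwap ω
    (fun p : E × E => localMaxwellian 1 θ u p.1 * localMaxwellian 1 θ u p.2 * hardSphereKernel p ω * ψ p.2)
  refine Eq.trans (integral_congr_ae (Eventually.of_forall fun p => ?_)) h
  simp only [Prod.fst_swap, Prod.snd_swap]
  rw [isGradCutoffKernel_hardSphereKernel.swap_collide p ω,
    mul_comm (localMaxwellian 1 θ u (collide ω p).2) (localMaxwellian 1 θ u (collide ω p).1),
    localMaxwellian_collide_mul]

/-- **Gain-term symmetry, second particle**: `∫∫ M M ((v−w)·ω)₊ ψ(w′) = ∫∫ M M ((v−w)·ω)₊ ψ(v)`.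
[cite: CIP1994, §3.1] -/
theorem integral_localMaxwellian_kernel_collide_snd (θ : ℝ) (u : E) (ω : sphere (0 : E) 1)
    (ψ : E → ℝ) :
    ∫ p, localMaxwellian 1 θ u p.1 * localMaxwellian 1 θ u p.2 * hardSphereKernel p ω *
        ψ (collide ω p).2 ∂((volume : Measure E).prod volume) =
      ∫ p, localMaxwellian 1 θ u p.1 * localMaxwellian 1 θ u p.2 * hardSphereKernel p ω * ψ p.1
        ∂((volume : Measure E).prod volume) := by
  have h := integral_comp_collideSwap ω
    (fun p : E × E => localMaxwellian 1 θ u p.1 * localMaxwellian 1 θ u p.2 * hardSphereKernel p ω * ψ p.1)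
  refine Eq.trans (integral_congr_ae (Eventually.of_forall fun p => ?_)) h
  simp only [Prod.fst_swap, Prod.snd_swap]
  rw [isGradCutoffKernel_hardSphereKernel.swap_collide p ω,
    mul_comm (localMaxwellian 1 θ u (collide ω p).2) (localMaxwellian 1 θ u (collide ω p).1),
    localMaxwellian_collide_mul]

end Velocity

/-! ## The bracket identity for a fixed impact direction -/

section Bracket

variable {E : Type*} [NormedAddCommGroup E] [InnerProductSpace ℝ E] [FiniteDimensional ℝ E]
  [MeasurableSpace E] [BorelSpace E]

omit [FiniteDimensional ℝ E] [MeasurableSpace E] [BorelSpace E] in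
/-- Quadratic velocity growth transported through the collision: if `|ψ| ≤ C (1 + ‖·‖²)` then the four
weights `ψ(v)`, `ψ(w)`, `ψ(v′)`, `ψ(w′)` are bounded by `C ((1 + ‖v‖)(1 + ‖w‖))²`. [folklore] -/
theorem quadGrowth_weights {ψ : E → ℝ} {C : ℝ} (hψ : ∀ v, |ψ v| ≤ C * (1 + ‖v‖ ^ 2))
    (ω : sphere (0 : E) 1) (p : E × E) :
    |ψ p.1| ≤ C * ((1 + ‖p.1‖) * (1 + ‖p.2‖)) ^ 2 ∧ |ψ p.2| ≤ C * ((1 + ‖p.1‖) * (1 + ‖p.2‖)) ^ 2 ∧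
      |ψ (collide ω p).1| ≤ C * ((1 + ‖p.1‖) * (1 + ‖p.2‖)) ^ 2 ∧
      |ψ (collide ω p).2| ≤ C * ((1 + ‖p.1‖) * (1 + ‖p.2‖)) ^ 2 := by
  have hC : 0 ≤ C := by
    have h := (abs_nonneg _).trans (hψ 0)
    simpa using h
  have hX := one_add_sq_add_sq_le (norm_nonneg p.1) (norm_nonneg p.2)
  have h1 : 1 + ‖p.1‖ ^ 2 ≤ ((1 + ‖p.1‖) * (1 + ‖p.2‖)) ^ 2 := by nlinarith [sq_nonneg ‖p.2‖]
  have h2 : 1 + ‖p.2‖ ^ 2 ≤ ((1 + ‖p.1‖) * (1 + ‖p.2‖)) ^ 2 := by nlinarith [sq_nonneg ‖p.1‖]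
  obtain ⟨hc1, hc2⟩ := norm_sq_collide_le ω p
  have h3 : 1 + ‖(collide ω p).1‖ ^ 2 ≤ ((1 + ‖p.1‖) * (1 + ‖p.2‖)) ^ 2 := by linarith
  have h4 : 1 + ‖(collide ω p).2‖ ^ 2 ≤ ((1 + ‖p.1‖) * (1 + ‖p.2‖)) ^ 2 := by linarith
  exact ⟨(hψ _).trans (mul_le_mul_of_nonneg_left h1 hC), (hψ _).trans (mul_le_mul_of_nonneg_left h2 hC),
    (hψ _).trans (mul_le_mul_of_nonneg_left h3 hC), (hψ _).trans (mul_le_mul_of_nonneg_left h4 hC)⟩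

/-- Integrability of the four Maxwellian-weighted pieces `M M ((v−w)·ω)₊ ψ(·)` evaluated at `v`, `w`,
`v′`, `w′`, for a continuous `ψ` of quadratic growth. [folklore] -/
theorem integrable_localMaxwellian_kernel_quad {θ : ℝ} (hθ : 0 < θ) (u : E) (ω : sphere (0 : E) 1)
    {ψ : E → ℝ} (hψc : Continuous ψ) {C : ℝ} (hψ : ∀ v, |ψ v| ≤ C * (1 + ‖v‖ ^ 2)) :
    Integrable (fun p : E × E => localMaxwellian 1 θ u p.1 * localMaxwellian 1 θ u p.2 *
        hardSphereKernel p ω * ψ p.1) ((volume : Measure E).prod volume) ∧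
    Integrable (fun p : E × E => localMaxwellian 1 θ u p.1 * localMaxwellian 1 θ u p.2 *
        hardSphereKernel p ω * ψ p.2) ((volume : Measure E).prod volume) ∧
    Integrable (fun p : E × E => localMaxwellian 1 θ u p.1 * localMaxwellian 1 θ u p.2 *
        hardSphereKernel p ω * ψ (collide ω p).1) ((volume : Measure E).prod volume) ∧
    Integrable (fun p : E × E => localMaxwellian 1 θ u p.1 * localMaxwellian 1 θ u p.2 *
        hardSphereKernel p ω * ψ (collide ω p).2) ((volume : Measure E).prod volume) := by
  have hcol : Continuous (fun p : E × E => collide ω p) := continuous_collide ω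
  refine ⟨?_, ?_, ?_, ?_⟩
  · exact integrable_localMaxwellian_kernel_mul hθ u ω (hψc.comp continuous_fst).aestronglyMeasurable
      (fun p => (quadGrowth_weights hψ ω p).1)
  · exact integrable_localMaxwellian_kernel_mul hθ u ω (hψc.comp continuous_snd).aestronglyMeasurable
      (fun p => (quadGrowth_weights hψ ω p).2.1)
  · exact integrable_localMaxwellian_kernel_mul hθ u ω (hψc.comp hcol.fst).aestronglyMeasurable
      (fun p => (quadGrowth_weights hψ ω p).2.2.1)
  · exact integrable_localMaxwellian_kernel_mul hθ u ω (hψc.comp hcol.snd).aestronglyMeasurable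
      (fun p => (quadGrowth_weights hψ ω p).2.2.2)

/-- Linear combination of four integrals (bookkeeping). [folklore] -/
theorem integral_add_sub_sub {α : Type*} [MeasurableSpace α] {μ : Measure α} {f₁ f₂ f₃ f₄ : α → ℝ}
    (h₁ : Integrable f₁ μ) (h₂ : Integrable f₂ μ) (h₃ : Integrable f₃ μ) (h₄ : Integrable f₄ μ) :
    ∫ a, (f₃ a + f₄ a - f₁ a - f₂ a) ∂μ =
      (∫ a, f₃ a ∂μ) + (∫ a, f₄ a ∂μ) - (∫ a, f₁ a ∂μ) - ∫ a, f₂ a ∂μ := by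
  have h34 : Integrable (fun a => f₃ a + f₄ a) μ := h₃.add h₄
  have h341 : Integrable (fun a => f₃ a + f₄ a - f₁ a) μ := h34.sub h₁
  rw [integral_sub h341 h₂, integral_sub h34 h₁, integral_add h₃ h₄]

/-- **The bracket identity.** For a fixed impact direction `ω`, two continuous velocity functions
`ψ₁ = φ(x, ·)`, `ψ₂ = φ(y, ·)` of quadratic growth and the local Maxwellian `M = M_{1,u,θ}`:
`∫∫ M(v)M(w)((v−w)·ω)₊ [ψ₁(v′) + ψ₂(w′) − ψ₁(v) − ψ₂(w)] dv dw = q(ψ₂) − q(ψ₁)`,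
`q(ψ) = ∫∫ M(v)M(w)((v−w)·ω)₊ (ψ(v) − ψ(w)) dv dw` — the gain terms are turned into loss-type terms
by the swapped collision change of variables. [cite: CIP1994, §3.1] -/
theorem integral_localMaxwellian_kernel_bracket {θ : ℝ} (hθ : 0 < θ) (u : E) (ω : sphere (0 : E) 1)
    {ψ₁ ψ₂ : E → ℝ} (h₁c : Continuous ψ₁) (h₂c : Continuous ψ₂) {C : ℝ}
    (h₁ : ∀ v, |ψ₁ v| ≤ C * (1 + ‖v‖ ^ 2)) (h₂ : ∀ v, |ψ₂ v| ≤ C * (1 + ‖v‖ ^ 2)) :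
    ∫ p, localMaxwellian 1 θ u p.1 * localMaxwellian 1 θ u p.2 * hardSphereKernel p ω *
        (ψ₁ (collide ω p).1 + ψ₂ (collide ω p).2 - ψ₁ p.1 - ψ₂ p.2) ∂((volume : Measure E).prod volume) =
      (∫ p, localMaxwellian 1 θ u p.1 * localMaxwellian 1 θ u p.2 * hardSphereKernel p ω *
          (ψ₂ p.1 - ψ₂ p.2) ∂((volume : Measure E).prod volume)) -
        ∫ p, localMaxwellian 1 θ u p.1 * localMaxwellian 1 θ u p.2 * hardSphereKernel p ω *
          (ψ₁ p.1 - ψ₁ p.2) ∂((volume : Measure E).prod volume) := by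
  obtain ⟨hA1, hA2, hA3, -⟩ := integrable_localMaxwellian_kernel_quad hθ u ω h₁c h₁
  obtain ⟨hB1, hB2, -, hB4⟩ := integrable_localMaxwellian_kernel_quad hθ u ω h₂c h₂
  have hgain₁ := integral_localMaxwellian_kernel_collide_fst θ u ω ψ₁
  have hgain₂ := integral_localMaxwellian_kernel_collide_snd θ u ω ψ₂
  have hL : ∫ p, localMaxwellian 1 θ u p.1 * localMaxwellian 1 θ u p.2 * hardSphereKernel p ω *
        (ψ₁ (collide ω p).1 + ψ₂ (collide ω p).2 - ψ₁ p.1 - ψ₂ p.2) ∂((volume : Measure E).prod volume) =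
      ∫ p, (localMaxwellian 1 θ u p.1 * localMaxwellian 1 θ u p.2 * hardSphereKernel p ω * ψ₁ (collide ω p).1 +
        localMaxwellian 1 θ u p.1 * localMaxwellian 1 θ u p.2 * hardSphereKernel p ω * ψ₂ (collide ω p).2 -
        localMaxwellian 1 θ u p.1 * localMaxwellian 1 θ u p.2 * hardSphereKernel p ω * ψ₁ p.1 -
        localMaxwellian 1 θ u p.1 * localMaxwellian 1 θ u p.2 * hardSphereKernel p ω * ψ₂ p.2)
        ∂((volume : Measure E).prod volume) :=
    integral_congr_ae (Eventually.of_forall fun p => by ring)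
  have hR₁ : ∫ p, localMaxwellian 1 θ u p.1 * localMaxwellian 1 θ u p.2 * hardSphereKernel p ω *
        (ψ₁ p.1 - ψ₁ p.2) ∂((volume : Measure E).prod volume) =
      (∫ p, localMaxwellian 1 θ u p.1 * localMaxwellian 1 θ u p.2 * hardSphereKernel p ω * ψ₁ p.1
        ∂((volume : Measure E).prod volume)) -
      ∫ p, localMaxwellian 1 θ u p.1 * localMaxwellian 1 θ u p.2 * hardSphereKernel p ω * ψ₁ p.2
        ∂((volume : Measure E).prod volume) := by
    rw [← integral_sub hA1 hA2]
    exact integral_congr_ae (Eventually.of_forall fun p => by ring)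
  have hR₂ : ∫ p, localMaxwellian 1 θ u p.1 * localMaxwellian 1 θ u p.2 * hardSphereKernel p ω *
        (ψ₂ p.1 - ψ₂ p.2) ∂((volume : Measure E).prod volume) =
      (∫ p, localMaxwellian 1 θ u p.1 * localMaxwellian 1 θ u p.2 * hardSphereKernel p ω * ψ₂ p.1
        ∂((volume : Measure E).prod volume)) -
      ∫ p, localMaxwellian 1 θ u p.1 * localMaxwellian 1 θ u p.2 * hardSphereKernel p ω * ψ₂ p.2
        ∂((volume : Measure E).prod volume) := by
    rw [← integral_sub hB1 hB2]
    exact integral_congr_ae (Eventually.of_forall fun p => by ring)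
  rw [hL, integral_add_sub_sub hA1 hB2 hA3 hB4, hR₁, hR₂, hgain₁, hgain₂]
  ring

/-- A uniform bound for the loss-type functional `q(ψ) = ∫∫ M M ((v−w)·ω)₊ (ψ(v) − ψ(w))`:
`|q(ψ)| ≤ 2 C m²`, `m = ∫ (1 + ‖v‖)³ M(v) dv`, for `|ψ| ≤ C(1 + ‖·‖²)`. [folklore] -/
theorem abs_integral_localMaxwellian_kernel_sub_le {θ : ℝ} (hθ : 0 < θ) (u : E) (ω : sphere (0 : E) 1)
    {ψ : E → ℝ} {C : ℝ} (hψ : ∀ v, |ψ v| ≤ C * (1 + ‖v‖ ^ 2)) :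
    |∫ p, localMaxwellian 1 θ u p.1 * localMaxwellian 1 θ u p.2 * hardSphereKernel p ω *
        (ψ p.1 - ψ p.2) ∂((volume : Measure E).prod volume)| ≤
      2 * C * (∫ v, (1 + ‖v‖) ^ 3 * localMaxwellian 1 θ u v) ^ 2 := by
  have hC : 0 ≤ C := by
    have h := (abs_nonneg _).trans (hψ 0)
    simpa using h
  set ρ : E → ℝ := fun v => (1 + ‖v‖) ^ 3 * localMaxwellian 1 θ u v with hρ
  have hρi : Integrable ρ := integrable_one_add_norm_pow_mul_localMaxwellian hθ u 3
  have hdom : Integrable (fun p : E × E => 2 * C * (ρ p.1 * ρ p.2)) ((volume : Measure E).prod volume) :=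
    (hρi.mul_prod hρi).const_mul _
  have hbound : ∀ p : E × E, ‖localMaxwellian 1 θ u p.1 * localMaxwellian 1 θ u p.2 * hardSphereKernel p ω *
      (ψ p.1 - ψ p.2)‖ ≤ 2 * C * (ρ p.1 * ρ p.2) := by
    intro p
    obtain ⟨hw1, hw2, -, -⟩ := quadGrowth_weights hψ ω p
    have hMv := localMaxwellian_nonneg zero_le_one hθ.le u p.1
    have hMw := localMaxwellian_nonneg zero_le_one hθ.le u p.2
    have hK0 := UkaiLanford.hardSphereKernel_nonneg' p ω
    have hK := UkaiLanford.hardSphereKernel_le_weight p ω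
    set X : ℝ := (1 + ‖p.1‖) * (1 + ‖p.2‖) with hX
    have hX0 : 0 ≤ X := by positivity
    have hsub : |ψ p.1 - ψ p.2| ≤ 2 * C * X ^ 2 := by
      calc |ψ p.1 - ψ p.2| ≤ |ψ p.1| + |ψ p.2| := abs_sub _ _
        _ ≤ C * X ^ 2 + C * X ^ 2 := add_le_add hw1 hw2
        _ = 2 * C * X ^ 2 := by ring
    rw [Real.norm_eq_abs, abs_mul, abs_mul, abs_mul, abs_of_nonneg hMv, abs_of_nonneg hMw,
      abs_of_nonneg hK0]
    have hρvw : ρ p.1 * ρ p.2 = X ^ 3 * (localMaxwellian 1 θ u p.1 * localMaxwellian 1 θ u p.2) := by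
      simp only [hρ, hX, mul_pow]
      ring
    calc localMaxwellian 1 θ u p.1 * localMaxwellian 1 θ u p.2 * hardSphereKernel p ω * |ψ p.1 - ψ p.2|
        ≤ localMaxwellian 1 θ u p.1 * localMaxwellian 1 θ u p.2 * X * (2 * C * X ^ 2) :=
          mul_le_mul (mul_le_mul_of_nonneg_left hK (mul_nonneg hMv hMw)) hsub (abs_nonneg _)
            (by positivity)
      _ = 2 * C * (ρ p.1 * ρ p.2) := by rw [hρvw]; ring
  have h := norm_integral_le_of_norm_le hdom (Eventually.of_forall hbound)
  rw [Real.norm_eq_abs] at h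
  refine h.trans_eq ?_
  rw [integral_const_mul, integral_prod_mul (μ := (volume : Measure E)) (ν := (volume : Measure E)) ρ ρ, sq]

end Bracket

end Summit.AtomisticToContinuum.HydrodynamicLimit.Theorems.EnskogAdjointDuality

end
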